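import Summits.ResolutionOfSingularities.ResolutionOfSingularities.Theorems.HilbertSamuelEliminationSigmaMaxModificationsCorridor3WLadderIsoInsepSplitMilnorAlgebra
import Summits.ResolutionOfSingularities.ResolutionOfSingularities.Theorems.HilbertSamuelEliminationSigmaMaxModificationsCorridor3WLadderIsolatedCompletion
import Summits.ResolutionOfSingularities.ResolutionOfSingularities.Theorems.HilbertSamuelEliminationSigmaMaxModificationsCorridor3WLadderGradeOneUnits
import Summits.ResolutionOfSingularities.ResolutionOfSingularities.Theorems.HilbertSamuelEliminationSigmaMaxModificationsCorridor3WLadderAlgIsolatedScheme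
import Summits.ResolutionOfSingularities.ResolutionOfSingularities.Theorems.HilbertSamuelEliminationSigmaMaxModificationsCorridor3WLadderIsoTailTower
import Summits.ResolutionOfSingularities.ResolutionOfSingularities.Theorems.HilbertSamuelEliminationSigmaMaxModificationsCorridor3WLadderLocalTower
import Summits.ResolutionOfSingularities.ResolutionOfSingularities.Theorems.HilbertSamuelEliminationSigmaMaxModificationsCorridor3HypersurfacePoints
import Summits.ResolutionOfSingularities.ResolutionOfSingularities.Theorems.HilbertSamuelEliminationSigmaMaxModificationsCorridor3QuadricGap
import Literature.AlgebraicGeometry.Resolution.NagataJacobianCriterion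
import Literature.AlgebraicGeometry.CossartJannsenSaito2020.BlowupTowerLocalizeTransfer
import Literature.AlgebraicGeometry.Resolution.HilbertSamuelSemicontinuitySharp
import Literature.AlgebraicGeometry.Resolution.QuasiExcellentSchemes
import Literature.AlgebraicGeometry.Resolution.ExcellentRingsFieldProofs
import Literature.AlgebraicGeometry.Resolution.AdicCompletionRegular
import Literature.AlgebraicGeometry.Resolution.NormalCrossingsStrictification
import Literature.AlgebraicGeometry.Resolution.SmoothFibreChart
import Literature.AlgebraicGeometry.Resolution.RegularLocalRingsQuotient
import Mathlib.RingTheory.Filtration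
import HarnessLib

/-!
# [OURS · L1 W4.2] k2 row S-fin₂ `SplitMilnorFinite₂` PROVED modulo Nagata's Jacobian criterion (crux chain w42, cell k2 `T3insep`;
# `--supports stmt-ResolutionOfSingularities-19249`)

OURS (cell res-hironaka, slot W4.2, seat res-D-pv-042; res-L1-w42-plan-1 RULING v3.14-16a (EU), CUT 12:02:38Z); NOT a statement of
[Hironaka2017] nor of [CossartJannsenSaito2020] / [Matsumura1987]. AI-drafted, weaker than expert review. HELPER file (no definition):
the row `IdeasL1C6.SplitMilnorFinite₂ N` of k2 PART 2′ (`…Corridor3WLadderIsoInsepCellsDefs`, res-L1-w42-idea-1 Sketch C8 §10) is PROVED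
at every level `N`, CONDITIONALLY on the ONE statement-only Literature fact
`Literature.AlgebraicGeometry.Resolution.Matsumura1987_30_10_hypersurface` (Nagata's Jacobian criterion for `k⟦X⟧`, Matsumura Thm. 30.10,
direction (1) ⇒ (2), hypersurface case).

* §1 `isRegularLocalRing_atPrime_quotient_of_isolated_doublePoint` — **an isolated double point has no other singular point**: for `R`
  regular local of dimension `e ≤ N + 1`, `f ∈ 𝔪² ∖ 𝔪³`, if the closed point of `Spec R/(f)` is isolated in its `H^N`-maximal locus then
  `R_P/(f)` is REGULAR for every non-maximal prime `P ∋ f` (else `ord_{R_P} f = m' ≥ 2` and `H^N(P̄) = hypersurfaceHFe (N+1) m' ≥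
  hypersurfaceHFe (N+1) 2 = H^N(𝔪̄)` by the tree's `Helpers.hsFun_eq_hypersurfaceHFe_of_stalk_ringEquiv`, so the generization `P̄ ⤳ 𝔪̄`
  would lie in the maximal locus, `IdeasL1C4.eq_of_isIsolatedInHSMaxLocus_of_hsFun_le`).
* §2 `splitMilnor_lt_top_of_isIsolated` — the STAGE-LOCAL form (res-type-067 R1): for a scheme `X` locally of finite type over a field,
  `dim X ≤ N`, and a point `x` ISOLATED in `X_max(N)` carrying a 2-rank-one split presentation `Ô_{X,x} ≅ κ⟦x,y,z,w⟧/(x² + λy² + g)`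
  (`IsPBSplitInsepAt X x`): `splitMilnor X x < ⊤`.  Route: isolation at `x` ⇒ at the closed point of `Spec 𝒪_{X,x}` (CJS
  `isIsolatedInHSMaxLocus_localize`, u.s.c. over a field) ⇒ of `Spec Ô` (H8 `IdeasL1C4.isIsolatedInHSMaxLocus_adicCompletion_of_ringEquiv`,
  `𝒪_{X,x}` excellent and a quotient of a regular local ring) ⇒ of `Spec κ⟦X⟧/(F)` (`Moving.isIsolatedInHSMaxLocus_spec_of_iso`) ⇒ §1
  ⇒ Nagata ⇒ the algebra half `IdeasL1C6.moduleFinite_milnorAlg_of_jacobian` (`…IsoInsepSplitMilnorAlgebra`) ⇒ `κ⟦z,w⟧/(g_z,g_w)` finite.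
* §3 `splitMilnorFinite₂_of_nagata : Matsumura1987_30_10_hypersurface → ∀ N, SplitMilnorFinite₂ N` (specialisation to an isolated
  point tower over a maximal origin: `exists_towerStructure`, `tower_dim_le`).

Honest status: CONDITIONAL on the named fact (net: the row is a theorem modulo Matsumura Thm. 30.10); no other hypothesis.
-/

noncomputable section

set_option linter.dupNamespace false

open scoped Classical
open CategoryTheory AlgebraicGeometry TopologicalSpace IsLocalRing MvPowerSeries
open Literature.AlgebraicGeometry.Resolution Literature.RingTheory.HilbertSamuel
open Literature.AlgebraicGeometry.CossartJannsenSaito2020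
open Summit.ResolutionOfSingularities.ResolutionOfSingularities.Theorems.CampaignW42
open Summit.ResolutionOfSingularities.ResolutionOfSingularities.Theorems.SigmaMaxModificationsCorridor3
open Summit.ResolutionOfSingularities.ResolutionOfSingularities.Theorems.SigmaMaxModificationsCorridor3.Helpers (hypersurfaceHFe)
open Summit.ResolutionOfSingularities.ResolutionOfSingularities.Cruxes.SigmaMaxModifications.IdeasL1Idea2R4 (IsIsoPointTower)

namespace Summit.ResolutionOfSingularities.ResolutionOfSingularities.Cruxes.SigmaMaxModifications.IdeasL1C6

/-! ## §1. An isolated double point has no other singular point -/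

section DoublePoint

universe u

/-- The exact `𝔪`-adic order of a non-zero element of a noetherian local ring, above a known lower bound. [folklore] -/
theorem exists_exact_order_of_mem_pow {A : Type u} [CommRing A] [IsNoetherianRing A] [IsLocalRing A] {a : A} (ha : a ≠ 0)
    {m₀ : ℕ} (hm₀ : a ∈ maximalIdeal A ^ m₀) : ∃ m, m₀ ≤ m ∧ a ∈ maximalIdeal A ^ m ∧ a ∉ maximalIdeal A ^ (m + 1) := by
  have hex : ∃ n, a ∉ maximalIdeal A ^ n := by
    by_contra hall
    push Not at hall
    have hmem : a ∈ ⨅ n, maximalIdeal A ^ n := Ideal.mem_iInf.mpr hall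
    rw [Ideal.iInf_pow_eq_bot_of_isLocalRing _ (maximalIdeal.isMaximal A).ne_top, Ideal.mem_bot] at hmem
    exact ha hmem
  let n₀ := Nat.find hex
  have hn₀ : a ∉ maximalIdeal A ^ n₀ := Nat.find_spec hex
  have hlt : m₀ < n₀ := by
    by_contra hle
    rw [not_lt] at hle
    exact hn₀ (Ideal.pow_le_pow_right hle hm₀)
  refine ⟨n₀ - 1, by omega, ?_, by rw [show n₀ - 1 + 1 = n₀ by omega]; exact hn₀⟩
  have := Nat.find_min hex (m := n₀ - 1) (by omega)
  simpa using this

/-- **§1. An ISOLATED DOUBLE POINT has no other singular point.** Let `R` be a regular local ring of dimension `e ≤ N + 1`,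
`f ∈ 𝔪² ∖ 𝔪³`, and suppose the closed point of `Spec R/(f)` is isolated in the `H^N`-maximal locus. Then for every
NON-MAXIMAL prime `P ∋ f` of `R`, the local ring `R_P/(f)R_P` is regular. (Otherwise `ord_{R_P} f = m' ≥ 2`, the point `P̄ = P/(f)`
has `H^N(P̄) = hypersurfaceHFe (N+1) m' ≥ hypersurfaceHFe (N+1) 2 = H^N(𝔪̄)` and specialises to the closed point — impossible at an
isolated point of the maximal locus.) [OURS · L1 W4.2 · k2 S-fin₂] [folklore] -/
theorem isRegularLocalRing_atPrime_quotient_of_isolated_doublePoint {R : Type u} [CommRing R] [IsRegularLocalRing R]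
    {e N : ℕ} (he : ringKrullDim R = e) (heN : e ≤ N + 1) {f : R} (hf2 : f ∈ maximalIdeal R ^ 2)
    (hf3 : f ∉ maximalIdeal R ^ 3) [IsLocalRing (R ⧸ Ideal.span {f})]
    (hiso : IsIsolatedInHSMaxLocus (Spec (CommRingCat.of (R ⧸ Ideal.span {f}))) N (closedPoint (R ⧸ Ideal.span {f})))
    (P : Ideal R) [P.IsPrime] (hfP : f ∈ P) (hP : P ≠ maximalIdeal R) :
    IsRegularLocalRing (Localization.AtPrime P ⧸ (Ideal.span {f}).map (algebraMap R (Localization.AtPrime P))) := by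
  haveI : IsDomain R := isDomain_of_isRegularLocalRing R
  have hIP : Ideal.span {f} ≤ P := (Ideal.span_singleton_le_iff_mem _).mpr hfP
  haveI hPb : (P.map (Ideal.Quotient.mk (Ideal.span {f}))).IsPrime := IsoTailsHS.isPrime_map_quotientMk_of_mem hfP
  set RP := Localization.AtPrime P with hRP
  haveI : IsRegularLocalRing RP := isRegularLocalRing_localization_atPrime R P
  haveI : IsDomain RP := isDomain_of_isRegularLocalRing RP
  set f' : RP := algebraMap R RP f with hf'
  have hIRP : (Ideal.span {f}).map (algebraMap R RP) = Ideal.span {f'} := by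
    rw [Ideal.map_span, Set.image_singleton]
  have hf0 : f ≠ 0 := fun h => hf3 (h ▸ zero_mem _)
  have hf'𝔪 : f' ∈ maximalIdeal RP := by
    rw [← Localization.AtPrime.map_eq_maximalIdeal]
    exact Ideal.mem_map_of_mem _ hfP
  have hf'0 : f' ≠ 0 := by
    intro h0
    exact hf0 ((IsLocalization.injective RP P.primeCompl_le_nonZeroDivisors).eq_iff.mp (h0.trans (map_zero _).symm))
  by_contra hreg
  -- `f' ∈ 𝔪_{R_P}²`, of exact order `m' ≥ 2`
  have hf'2 : f' ∈ maximalIdeal RP ^ 2 := by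
    by_contra h2
    apply hreg
    rw [hIRP]
    exact (IsRegularLocalRing.quotient_span_singleton hf'𝔪 h2).1
  obtain ⟨m', hm'2, hm'mem, hm'not⟩ := exists_exact_order_of_mem_pow hf'0 hf'2
  -- `dim R_P = e' ≤ e ≤ N + 1`
  have hdimle : ringKrullDim RP ≤ (e : WithBot ℕ∞) := by
    rw [IsLocalization.AtPrime.ringKrullDim_eq_height P RP, ← he]
    exact Ideal.height_le_ringKrullDim_of_isPrime
  obtain ⟨e', he'⟩ : ∃ e' : ℕ, ringKrullDim RP = e' := by
    obtain ⟨d, hd⟩ := WithBot.ne_bot_iff_exists.mp (ringKrullDim_ne_bot (R := RP))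
    have hd' : d ≤ (e : ℕ∞) := by rw [← hd] at hdimle; exact WithBot.coe_le_coe.mp hdimle
    have hdt : d ≠ ⊤ := ne_top_of_le_ne_top (ENat.coe_ne_top e) hd'
    refine ⟨d.toNat, ?_⟩
    rw [← hd, ← ENat.coe_toNat hdt]
    rfl
  have he'N : e' ≤ N + 1 := by
    have h1 : (e' : WithBot ℕ∞) ≤ (e : WithBot ℕ∞) := he' ▸ hdimle
    have h2 : e' ≤ e := by exact_mod_cast h1
    exact h2.trans heN
  -- the scheme `Y = Spec R/(f)` and its two points
  set B := R ⧸ Ideal.span {f} with hB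
  haveI : IsNoetherianRing B := Ideal.Quotient.isNoetherianRing _
  let y𝔪 : ↥(Spec (CommRingCat.of B)) := closedPoint B
  let yP : ↥(Spec (CommRingCat.of B)) := ⟨P.map (Ideal.Quotient.mk (Ideal.span {f})), hPb⟩
  -- stalk at the closed point `≅ B = R/(f)`
  letI alg𝔪 : Algebra B ((Spec (CommRingCat.of B)).presheaf.stalk y𝔪) := (StructureSheaf.toStalk B y𝔪).hom.toAlgebra
  haveI hloc𝔪 : IsLocalization.AtPrime ((Spec (CommRingCat.of B)).presheaf.stalk y𝔪) (maximalIdeal B) :=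
    StructureSheaf.IsLocalization.to_stalk B y𝔪
  let ε𝔪 : ((Spec (CommRingCat.of B)).presheaf.stalk y𝔪) ≃+* R ⧸ Ideal.span {f} :=
    (IsLocalization.atUnits B (maximalIdeal B).primeCompl (S := (Spec (CommRingCat.of B)).presheaf.stalk y𝔪) (by
      intro y hy
      exact not_not.mp fun hu => hy ((IsLocalRing.mem_maximalIdeal y).mpr hu))).toRingEquiv.symm
  -- stalk at `P̄` `≅ R_P/(f')`
  letI algP : Algebra B ((Spec (CommRingCat.of B)).presheaf.stalk yP) := (StructureSheaf.toStalk B yP).hom.toAlgebra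
  haveI hlocP : IsLocalization.AtPrime ((Spec (CommRingCat.of B)).presheaf.stalk yP)
      (P.map (Ideal.Quotient.mk (Ideal.span {f}))) := StructureSheaf.IsLocalization.to_stalk B yP
  have hinst : IsLocalization (Algebra.algebraMapSubmonoid (R ⧸ Ideal.span {f}) P.primeCompl)
      (RP ⧸ (Ideal.span {f}).map (algebraMap R RP)) := inferInstance
  rw [algebraMapSubmonoid_quotient_primeCompl P hIP] at hinst
  haveI : IsLocalization.AtPrime (RP ⧸ (Ideal.span {f}).map (algebraMap R RP))
      (P.map (Ideal.Quotient.mk (Ideal.span {f}))) := hinst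
  let εP : ((Spec (CommRingCat.of B)).presheaf.stalk yP) ≃+* RP ⧸ Ideal.span {f'} :=
    (IsLocalization.algEquiv (P.map (Ideal.Quotient.mk (Ideal.span {f}))).primeCompl
      ((Spec (CommRingCat.of B)).presheaf.stalk yP) (RP ⧸ (Ideal.span {f}).map (algebraMap R RP))).toRingEquiv.trans
      (Ideal.quotEquivOfEq hIRP)
  -- the two Hilbert–Samuel functions
  have hH𝔪 : Scheme.hsFun (Spec (CommRingCat.of B)) N y𝔪 = hypersurfaceHFe (N + 1) 2 :=
    Helpers.hsFun_eq_hypersurfaceHFe_of_stalk_ringEquiv he heN (m := 2) (by norm_num) hf2 hf3 ε𝔪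
  have hHP : Scheme.hsFun (Spec (CommRingCat.of B)) N yP = hypersurfaceHFe (N + 1) m' :=
    Helpers.hsFun_eq_hypersurfaceHFe_of_stalk_ringEquiv he' he'N (m := m') (by omega) hm'mem hm'not εP
  have hle : Scheme.hsFun (Spec (CommRingCat.of B)) N y𝔪 ≤ Scheme.hsFun (Spec (CommRingCat.of B)) N yP := by
    rw [hH𝔪, hHP]
    exact Helpers.hypersurfaceHFe_mono_right _ hm'2
  have hspec : yP ⤳ y𝔪 :=
    (PrimeSpectrum.le_iff_specializes (x := yP) (y := y𝔪)).mp (IsLocalRing.le_maximalIdeal (Ideal.IsPrime.ne_top hPb))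
  have heq : yP = y𝔪 := IdeasL1C4.eq_of_isIsolatedInHSMaxLocus_of_hsFun_le hiso hspec hle
  -- hence `P̄ = 𝔪̄` and `P = 𝔪`
  have hPm : P.map (Ideal.Quotient.mk (Ideal.span {f})) = maximalIdeal B := congrArg PrimeSpectrum.asIdeal heq
  apply hP
  have h1 : (P.map (Ideal.Quotient.mk (Ideal.span {f}))).comap (Ideal.Quotient.mk (Ideal.span {f})) = P := by
    rw [Ideal.comap_map_of_surjective _ Ideal.Quotient.mk_surjective, ← RingHom.ker_eq_comap_bot, Ideal.mk_ker]
    exact sup_eq_left.mpr hIP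
  have h2 : (maximalIdeal B).comap (Ideal.Quotient.mk (Ideal.span {f})) = maximalIdeal R := by
    haveI := Ideal.comap_isMaximal_of_surjective (Ideal.Quotient.mk (Ideal.span {f})) Ideal.Quotient.mk_surjective
      (K := maximalIdeal B)
    exact IsLocalRing.eq_maximalIdeal inferInstance
  rw [← h1, hPm, h2]

end DoublePoint

/-! ## §2. The stage-local form: `splitMilnor X x < ⊤` at an isolated 2-rank-one split point -/

section StageLocal

open Summit.ResolutionOfSingularities.ResolutionOfSingularities.Theorems.SigmaMaxModificationsCorridor3.Moving
  (isBlowup_id_vanishingIdeal_empty isIsolatedInHSMaxLocus_spec_of_iso)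

variable {κ : Type} [Field κ]

/-- `rename` along the last two of four variables maps the maximal ideal into the maximal ideal. [folklore] -/
theorem rename_natAdd_mem_maximalIdeal_pow {h : MvPowerSeries (Fin 2) κ} {n : ℕ}
    (hh : h ∈ maximalIdeal (MvPowerSeries (Fin 2) κ) ^ n) :
    rename (Fin.natAdd 2) h ∈ maximalIdeal (MvPowerSeries (Fin 4) κ) ^ n := by
  have hle : (maximalIdeal (MvPowerSeries (Fin 2) κ)).map (rename (Fin.natAdd 2)).toRingHom ≤
      maximalIdeal (MvPowerSeries (Fin 4) κ) := by
    rw [Ideal.map_le_iff_le_comap]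
    intro a ha
    rw [Ideal.mem_comap, Literature.RingTheory.MvPowerSeries.Jets.mem_maximalIdeal_iff_constantCoeff_eq_zero,
      AlgHom.toRingHom_eq_coe, RingHom.coe_coe, constantCoeff_rename]
    exact Literature.RingTheory.MvPowerSeries.Jets.mem_maximalIdeal_iff_constantCoeff_eq_zero.mp ha
  have h1 : rename (Fin.natAdd 2) h ∈ ((maximalIdeal (MvPowerSeries (Fin 2) κ)).map (rename (Fin.natAdd 2)).toRingHom) ^ n := by
    rw [← Ideal.map_pow]
    exact Ideal.mem_map_of_mem _ hh
  exact Ideal.pow_right_mono hle n h1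

/-- The `x²`-coefficient of `F = x² + λy² + g(z,w)` is `1`. [folklore] -/
theorem coeff_single_zero_two_splitEq (lam : κ) (g : MvPowerSeries (Fin 2) κ) :
    coeff (Finsupp.single (0 : Fin 4) 2) (splitEq 2 lam g) = 1 := by
  unfold splitEq
  rw [map_add, map_add, coeff_X_pow, if_pos rfl, coeff_C_mul, coeff_X_pow, if_neg, mul_zero, add_zero,
    coeff_rename_eq_zero, add_zero]
  · rintro ⟨d, hd⟩
    have h0 := congrArg (fun e : Fin 4 →₀ ℕ => e 0) hd
    simp only [Finsupp.single_eq_same] at h0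
    rw [Finsupp.mapDomain_notin_range] at h0
    · exact absurd h0 (by norm_num)
    · rintro ⟨j, hj⟩
      have := congrArg Fin.val hj
      simp [Fin.natAdd] at this
  · intro h
    have h1 := congrArg (fun e : Fin 4 →₀ ℕ => e 0) h
    simp at h1

/-- `F = x² + λy² + g` with `ord g ≥ 3` lies in `𝔪²` and not in `𝔪³`. [folklore] -/
theorem splitEq_mem_sq_not_mem_cube (lam : κ) {g : MvPowerSeries (Fin 2) κ} (hord : (2 : ℕ∞) < g.order) :
    splitEq 2 lam g ∈ maximalIdeal (MvPowerSeries (Fin 4) κ) ^ 2 ∧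
      splitEq 2 lam g ∉ maximalIdeal (MvPowerSeries (Fin 4) κ) ^ 3 := by
  constructor
  · unfold splitEq
    have hX : ∀ i : Fin 4, (X i : MvPowerSeries (Fin 4) κ) ∈ maximalIdeal (MvPowerSeries (Fin 4) κ) := fun i =>
      Literature.RingTheory.MvPowerSeries.Jets.mem_maximalIdeal_iff_constantCoeff_eq_zero.mpr (constantCoeff_X i)
    refine Ideal.add_mem _ (Ideal.add_mem _ ?_ ?_) ?_
    · rw [pow_two, pow_two]; exact Ideal.mul_mem_mul (hX 0) (hX 0)
    · rw [pow_two, pow_two, ← mul_assoc]; exact Ideal.mul_mem_mul (Ideal.mul_mem_left _ _ (hX 1)) (hX 1)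
    · have hg3 : g ∈ maximalIdeal (MvPowerSeries (Fin 2) κ) ^ 3 :=
        Literature.RingTheory.MvPowerSeries.Jets.mem_maximalIdeal_pow_of_le_order (Order.add_one_le_of_lt hord)
      exact Ideal.pow_le_pow_right (by norm_num) (rename_natAdd_mem_maximalIdeal_pow hg3)
  · intro h3
    have h0 := Literature.RingTheory.MvPowerSeries.Jets.coeff_eq_zero_of_mem_maximalIdeal_pow h3
      (e := Finsupp.single (0 : Fin 4) 2) (by rw [Finsupp.degree_single]; norm_num)
    rw [coeff_single_zero_two_splitEq] at h0
    exact one_ne_zero h0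

/-- **§2. THE STAGE-LOCAL FORM (res-type-067 R1).** Let `X` be a scheme locally of finite type over a field `k` with `dim X ≤ N`,
`x ∈ X` a point ISOLATED in the `H^N`-maximal locus carrying a 2-rank-one split presentation
`Ô_{X,x} ≅ κ⟦x,y,z,w⟧/(x² + λy² + g(z,w))` (`IsPBSplitInsepAt X x`). Then, granted Nagata's Jacobian criterion
(`Matsumura1987_30_10_hypersurface`), `splitMilnor X x < ⊤`: the Milnor algebra `κ⟦z,w⟧/(g_z, g_w)` of THAT presentation is finite.
[OURS · L1 W4.2 · k2 S-fin₂] [folklore] -/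
theorem splitMilnor_lt_top_of_isIsolated (hJ : Matsumura1987_30_10_hypersurface.{0}) {k : Type} [Field k]
    {X : Scheme.{0}} (f : X ⟶ Spec (.of k)) [LocallyOfFiniteType f] [IsLocallyNoetherian X] {N : ℕ} {x : X}
    (hN : topologicalKrullDim X ≤ (N : WithBot ℕ∞)) (hiso : IsIsolatedInHSMaxLocus X N x) (hsplit : IsPBSplitInsepAt X x) :
    splitMilnor X x < ⊤ := by
  obtain ⟨κ, _, lam, g, hchar, hlam, hpb, hord, ⟨e⟩⟩ := hsplit
  haveI := hchar
  -- reduce to the finiteness of the Milnor algebra of `g`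
  suffices hfin : Module.Finite κ (MilnorAlg g) by
    have h1 : splitMilnor X x ≤ milnorInf g := by
      unfold splitMilnor
      exact iInf_le_of_le κ (iInf_le_of_le inferInstance (iInf_le_of_le lam (iInf_le_of_le g
        (iInf_le_of_le ⟨hchar, hlam, hpb, hord, ⟨e⟩⟩ le_rfl))))
    have h2 : milnorInf g < ⊤ := by
      have : milnorInf g = (milnor g : ℕ∞) := by
        unfold milnorInf; rw [if_pos hfin]
      rw [this]; exact ENat.coe_lt_top _
    exact lt_of_le_of_lt h1 h2
  -- `g` has no constant and no linear terms
  have hg0 : constantCoeff g = 0 := by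
    rw [← coeff_zero_eq_constantCoeff_apply]
    exact coeff_of_lt_order (lt_trans (by simp) hord)
  have hg1 : ∀ s : Fin 2, coeff (Finsupp.single s 1) g = 0 := fun s =>
    coeff_of_lt_order (lt_trans (by rw [Finsupp.degree_single]; norm_num) hord)
  -- the regular local ring `S = κ⟦x,y,z,w⟧`, `F` of order exactly `2`
  set S := MvPowerSeries (Fin 4) κ with hS
  haveI : IsRegularLocalRing S := (isRegularLocalRing_mvPowerSeries_fin κ 4).1
  have hdimS : ringKrullDim S = (4 : ℕ) := (isRegularLocalRing_mvPowerSeries_fin κ 4).2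
  set F := splitEq 2 lam g with hF
  obtain ⟨hF2, hF3⟩ := splitEq_mem_sq_not_mem_cube lam hord
  have hF0 : F ≠ 0 := by
    intro h0
    apply hF3
    rw [show splitEq 2 lam g = F from rfl, h0]
    exact zero_mem _
  have hF𝔪 : F ∈ maximalIdeal S := Ideal.pow_le_self two_ne_zero hF2
  haveI : IsLocalRing (S ⧸ Ideal.span {F}) := IsoTailsHS.isLocalRing_quotient_span_singleton_of_mem hF𝔪
  -- the stalk `A = 𝒪_{X,x}`: excellent, `dim A ≤ N`, a quotient of a regular local ring, `Â ≅ S/(F)`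
  set A := X.presheaf.stalk x with hA
  have hexc : IsExcellentRing A :=
    isExcellentRing_stalk_of_isExcellent (Scheme.isExcellent_of_locallyOfFiniteType Stacks07QW_field_holds f) x
  have hdimA : ringKrullDim A ≤ N := (ringKrullDim_stalk_le_topologicalKrullDim X x).trans hN
  obtain ⟨S₁, _, _, σ₁, hσ₁⟩ := TameWild.exists_regular_presentation_stalk f x
  let e₁ : A ≃+* S₁ ⧸ RingHom.ker σ₁ := (RingHom.quotientKerEquivOfSurjective hσ₁).symm
  -- `dim A = 3 ≤ N`
  have h3N : 3 ≤ N := by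
    haveI : IsNoetherianRing (AdicCompletion (maximalIdeal A) A) := isNoetherianRing_adicCompletion_maximalIdeal A
    have h1 : ringKrullDim (AdicCompletion (maximalIdeal A) A) = ringKrullDim (S ⧸ Ideal.span {F}) :=
      ringKrullDim_eq_of_ringEquiv e
    haveI : IsDomain S := isDomain_of_isRegularLocalRing S
    have h2 : ringKrullDim (S ⧸ Ideal.span {F}) + 1 = ringKrullDim S :=
      ringKrullDim_quotient_span_singleton_succ_eq_ringKrullDim_of_mem_nonZeroDivisors
        (mem_nonZeroDivisors_of_ne_zero hF0) hF𝔪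
    rw [ringKrullDim_adicCompletion] at h1
    have h4 : ringKrullDim A + 1 = ((4 : ℕ) : WithBot ℕ∞) := by rw [h1, h2, hdimS]
    have h5 : ringKrullDim A + 1 ≤ (N : WithBot ℕ∞) + 1 := add_le_add hdimA le_rfl
    rw [h4] at h5
    have : ((4 : ℕ) : WithBot ℕ∞) ≤ ((N + 1 : ℕ) : WithBot ℕ∞) := by push_cast; exact h5
    have : (4 : ℕ) ≤ N + 1 := by exact_mod_cast this
    omega
  -- ISOLATION: `X` at `x` ⇒ `Spec 𝒪_{X,x}` ⇒ `Spec Ô` ⇒ `Spec S/(F)`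
  have hsc : ∀ y : X, y ⤳ x → Scheme.hsFun X N y ≤ Scheme.hsFun X N x := fun y hy =>
    Scheme.hsFun_le_hsFun_of_specializes_over_field f N hy
  let T₀ : BlowupTower.{0} :=
    { X := fun _ => X, ln := fun _ => inferInstance, C := fun _ => ∅, isClosed_C := fun _ => isClosed_empty,
      π := fun _ => 𝟙 X, isBlowup := fun _ => isBlowup_id_vanishingIdeal_empty X }
  have hiso₁ : IsIsolatedInHSMaxLocus (Spec (X.presheaf.stalk x)) N (closedPoint (X.presheaf.stalk x)) :=
    T₀.isIsolatedInHSMaxLocus_localize x N hsc hiso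
  have hiso₂ : IsIsolatedInHSMaxLocus (Spec (CommRingCat.of (AdicCompletion (maximalIdeal A) A))) N
      (closedPoint (AdicCompletion (maximalIdeal A) A)) :=
    IdeasL1C4.isIsolatedInHSMaxLocus_adicCompletion_of_ringEquiv A hexc (RingHom.ker σ₁) e₁ N hdimA hiso₁
  haveI : IsNoetherianRing (AdicCompletion (maximalIdeal A) A) := isNoetherianRing_adicCompletion_maximalIdeal A
  haveI : IsNoetherianRing (S ⧸ Ideal.span {F}) := Ideal.Quotient.isNoetherianRing _
  have hiso₃ : IsIsolatedInHSMaxLocus (Spec (CommRingCat.of (S ⧸ Ideal.span {F}))) N (closedPoint (S ⧸ Ideal.span {F})) :=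
    isIsolatedInHSMaxLocus_spec_of_iso e.toCommRingCatIso N hiso₂
  -- §1 ⇒ regular at every non-maximal prime ∋ F; Nagata ⇒ the Jacobian row does not vanish there; the algebra half concludes
  refine moduleFinite_milnorAlg_of_jacobian hlam hpb hg0 hg1 fun P hP hPm hFP => ?_
  haveI := hP
  have hreg : IsRegularLocalRing (Localization.AtPrime P ⧸ (Ideal.span {F}).map (algebraMap S (Localization.AtPrime P))) :=
    isRegularLocalRing_atPrime_quotient_of_isolated_doublePoint hdimS (by omega) hF2 hF3 hiso₃ P hFP hPm
  exact hJ 2 κ Nat.prime_two 4 F P hF0 hFP hreg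

end StageLocal

/-! ## §3. The row `SplitMilnorFinite₂` along an isolated point tower over a maximal origin -/

section Row

open Summit.ResolutionOfSingularities.ResolutionOfSingularities.Theorems.SigmaMaxModificationsCorridor3.Moving
  (exists_towerStructure tower_dim_le)

/-- **S-fin₂ PROVED modulo Nagata's criterion**: `Matsumura1987_30_10_hypersurface → SplitMilnorFinite₂ N` for every level `N` —
at every stage `x_n` of an isolated E3 point tower over a maximal origin of characteristic two that carries a 2-rank-one split
presentation, the split Milnor number is finite. (The stages are of finite type over the field of the origin, `exists_towerStructure`;
`dim X_n ≤ N`, `tower_dim_le`; then §2.) [OURS · L1 W4.2 · k2 S-fin₂ · cell k2 of `IsoQuadraticTowerTerminates p 3`] [folklore] -/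
theorem splitMilnorFinite₂_of_nagata (hJ : Matsumura1987_30_10_hypersurface.{0}) (N : ℕ) : SplitMilnorFinite₂ N := by
  intro ν T pt hO hT n hsplit
  obtain ⟨k, _, _, f₀, hsep, hft, hqc⟩ := hO.exists_structure
  haveI := hsep
  haveI := hft
  haveI := hqc
  obtain ⟨f, -, hf1, -⟩ := exists_towerStructure T f₀
  haveI := hf1 n
  haveI : IsLocallyNoetherian (T.X n) := T.ln n
  have hdim : topologicalKrullDim (T.X n) ≤ ((N : ℕ) : WithBot ℕ∞) := tower_dim_le T hO.dim_le n
  have hiso : IsIsolatedInHSMaxLocus (T.X n) N (pt n) := hT.2.2.2.2.1 n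
  exact splitMilnor_lt_top_of_isIsolated hJ (f n) hdim hiso hsplit

end Row


end Summit.ResolutionOfSingularities.ResolutionOfSingularities.Cruxes.SigmaMaxModifications.IdeasL1C6

end
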